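import Summits.BirchSwinnertonDyer.BirchSwinnertonDyer.Theorems.ByReductionTypeAtTwoFineSelmerConjAAtTwoAdditivePotGoodCoinvariantGenusCertificate51992LayerOne
import Summits.BirchSwinnertonDyer.BirchSwinnertonDyer.Theorems.ByReductionTypeAtTwoFineSelmerConjAAtTwoAdditivePotGoodCoinvariantGenusCertificate28712Layers
import HarnessLib

/-!
# Route `ByReductionTypeAtTwo` (rung K4), crux C1″ `FineSelmerConjAAtTwoAdditivePotGood` (item stmt-BirchSwinnertonDyer-22615, cc C3″ 22617):
# THE CENSUS ROW `467928d1` — THE `r = 1` INPUT OF THE COINVARIANT-GENUS ROAD ON THE ABSTRACT LAYERS `K₁ ⊂ K₂` OF EVERY CYCLOTOMIC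
# `ℤ₂`-EXTENSION OF THE TOTALLY REAL CUBIC POINT FIELD `ℚ(θ)` (`θ³ − θ² − 102θ − 342 = 0`, `d = 51992`): a unit of `K₁` that is NOT a norm from `K₂`,
# in the `hu / hnot` currency of `AddKatoTwo.two_dvd_relIndex_of_nonNorm` (KERNEL; a `--supports 22615` file; seat `bsd-2adic-k4-w1` GEN 12; twin of
# `…CoinvariantGenusCertificate28712Layers` / `…9980Layers`)

HONEST FRAMING (cell `bsd-2adic`, D-0036/D-0054/D-0152): KERNEL theorems; no elliptic curve, no named fact, no `sorry`, no definition.  Closes nothing at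
the `∀`-level; nothing booked.  WHAT IT IS FOR: with `h(ℚ(θ)) = 1` (`classNumber_eq_one_of_root_d51992p`), `n₀ = 0` (`forall_totallyRamifiedFrom_zero_h467928d1`),
two dyadic primes and k4-w2's genus criterion `classicalMuVanishes_of_rank_add_le_layer_succ_succ`: CLASSICAL `μ₂ = 0` along every cyclotomic `ℤ₂`-extension
of `ℚ(θ)` — input (a) of `SteinbergFibreAtTwo.NarrowMu.conjA_two_cubicModel_of_narrowMu` for the `Δ > 0` row `467928d1`; input (b) is NOT touched.  BSD is NOT proved.

THE ARGUMENT is that of the `315832c1` twin with the unit taken in the CUBIC field (`u = −29 − 11θ − θ²`): `K₁ = κ.layer 1 ∋ s`, `s² = 2`, `K₂ = κ.layer 2 ∋ e`,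
`e⁴ − 4e² + 2 = 0`, `e² = 2 ± s`, `e ∉ K₁`; `exists_unit_forall_sq_sub_mul_sq_ne_d51992` at `F = K₁` with `±s`; then
`exists_unitsIncl_not_mem_norm_of_forall_sq_sub_mul_sq_ne` (file `…28712Layers`).

References: [Omeara1963] §63B (63:10); [Washington1997] §13.1, §13.3 Prop. 13.22–13.23; [Gras2003] IV.4; [Lang1990] Ch. 13 §4 Lemma 4.1–4.2.
-/

set_option autoImplicit false
-- sibling precedent: the directory name repeats the summit name
set_option linter.dupNamespace false

noncomputable section

open scoped Classical IntermediateField NumberField nonZeroDivisors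

namespace Summit.BirchSwinnertonDyer.BirchSwinnertonDyer.Theorems.AddKatoTwo

open Polynomial IsDedekindDomain NumberField Field IntermediateField
  Literature.NumberTheory.EllipticCurves Literature.NumberTheory.EllipticCurves.ZpExtension
  Literature.NumberTheory.IwasawaTheory Literature.NumberTheory.NumberFields Literature.NumberTheory.NumberFields.AmbiguousClass
  Literature.NumberTheory.GaloisRepresentations Literature.NumberTheory.GaloisRepresentations.Herbrand
  Literature.NumberTheory.GaloisRepresentations.MinkowskiUnit Literature.NumberTheory.GaloisRepresentations.CyclicNormIndex

set_option maxHeartbeats 800000 in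
/-- ★ **A unit of `K₁` outside `N_{Gal(K₂/K₁)} K₂ˣ` for the cubic point field of `467928d1`** (`K` any cubic number field containing a root `θ` of
`X³ − X² − 102X − 342`, `d = 51992`, totally real): for every cyclotomic `ℤ₂`-extension `κ` of `K` and every algebra structure `κ.layer 1 → κ.layer 2`
compatible with `K`, there is `u ∈ (κ.layer 2)ˣ` in `E_{K₁}` and not in `N_G (κ.layer 2)ˣ` — the `r = 1` of the genus road (classical `μ₂ = 0`, input (a) of
the narrow-μ door only).  KERNEL: `K₁ ∋ √2`, `K₂ ∋ √(2 ± √2)`, and `exists_unit_forall_sq_sub_mul_sq_ne_d51992` (the cubic unit `u = −29 − 11θ − θ²`).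
BSD for `467928d1` is NOT proved by this. [cite: Washington1997, §13.1 and §13.3 Prop. 13.22–13.23] [cite: Omeara1963, §63B (63:10)] [cite: Gras2003, IV.4] -/
theorem exists_nonNorm_unit_layers_d51992 (K : Type) [Field K] [NumberField K] (h3 : Module.finrank ℚ K = 3) (b : 𝓞 K)
    (hb : b ^ 3 + (-1 : ℤ) * b ^ 2 + (-102 : ℤ) * b + (-342 : ℤ) = 0) (κ : ZpExtension K 2) (hκ : κ.IsCyclotomic)
    [NumberField (κ.layer 1)] [NumberField (κ.layer 2)] [Algebra (κ.layer 1) (κ.layer 2)] [IsScalarTower K (κ.layer 1) (κ.layer 2)] :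
    ∃ u : (κ.layer 2)ˣ, u ∈ unitsE (κ.layer 2) ⊓ (unitsIncl (κ.layer 1) (κ.layer 2)).range ∧
      u ∉ unitsE (κ.layer 2) ⊓ (⊤ : Subgroup (κ.layer 2)ˣ).map (Herbrand.norm ((κ.layer 2) ≃ₐ[κ.layer 1] (κ.layer 2))) := by
  have hodd : Odd (Module.finrank ℚ K) := by rw [h3]; decide
  have hnd : ¬ 2 ∣ Module.finrank ℚ K := by rw [h3]; norm_num
  haveI : FiniteDimensional K (κ.layer 1) := κ.finiteDimensional_layer_holds 1
  haveI : FiniteDimensional K (κ.layer 2) := κ.finiteDimensional_layer_holds 2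
  haveI : FiniteDimensional (κ.layer 1) (κ.layer 2) := Module.Finite.of_restrictScalars_finite K (κ.layer 1) (κ.layer 2)
  haveI : IsGalois (κ.layer 1) (κ.layer 2) := isGalois_layer_layer κ
  have h2M : Module.finrank K (κ.layer 1) = 2 := by rw [κ.finrank_layer_holds 1]; norm_num
  have h2L : Module.finrank (κ.layer 1) (κ.layer 2) = 2 := by rw [finrank_layer_layer κ (by norm_num : 1 ≤ 2)]; norm_num
  -- `s ∈ K₁`, `s² = 2`; `e ∈ K₂`, `e⁴ − 4e² + 2 = 0`
  obtain ⟨s, hs⟩ := exists_sq_eq_two_layer_one_of_not_dvd_finrank hnd κ hκ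
  obtain ⟨e, he⟩ := exists_quartic_root_layer_two_of_not_dvd_finrank hnd κ hκ
  -- `e ∉ K₁`
  have heM : e ∉ Set.range (algebraMap (κ.layer 1) (κ.layer 2)) := by
    rintro ⟨y, hy⟩
    have hy4 : y ^ 4 - 4 * y ^ 2 + 2 = 0 := by
      apply (algebraMap (κ.layer 1) (κ.layer 2)).injective
      rw [map_add, map_sub, map_mul, map_pow, map_pow, map_ofNat, map_ofNat, map_zero, hy]
      exact he
    have h4 := finrank_adjoin_quartic_root hodd y hy4
    have htower := Module.finrank_mul_finrank K ↥K⟮y⟯ (κ.layer 1)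
    rw [h4, h2M] at htower
    omega
  -- `e² = 2 + s` or `e² = 2 − s`
  have hprod : (e ^ 2 - algebraMap (κ.layer 1) (κ.layer 2) (2 + s)) * (e ^ 2 - algebraMap (κ.layer 1) (κ.layer 2) (2 - s)) = 0 := by
    have hs' : (algebraMap (κ.layer 1) (κ.layer 2) s) ^ 2 = 2 := by rw [← map_pow, hs, map_ofNat]
    rw [map_add, map_sub, map_ofNat]
    linear_combination he - hs'
  rcases mul_eq_zero.mp hprod with h1 | h1
  · obtain ⟨η, hne⟩ := exists_unit_forall_sq_sub_mul_sq_ne_d51992 K (κ.layer 1) h3 h2M b hb s hs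
    exact exists_unitsIncl_not_mem_norm_of_forall_sq_sub_mul_sq_ne h2L (sub_eq_zero.mp h1) heM η hne
  · have hs' : (-s) ^ 2 = 2 := by rw [neg_sq]; exact hs
    obtain ⟨η, hne⟩ := exists_unit_forall_sq_sub_mul_sq_ne_d51992 K (κ.layer 1) h3 h2M b hb (-s) hs'
    refine exists_unitsIncl_not_mem_norm_of_forall_sq_sub_mul_sq_ne h2L (m := 2 + -s) ?_ heM η hne
    rw [← sub_eq_add_neg]; exact sub_eq_zero.mp h1

end Summit.BirchSwinnertonDyer.BirchSwinnertonDyer.Theorems.AddKatoTwo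

end
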